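import Literature.NumberTheory.ModularForms.LevelSixEisensteinQExpansions
import Literature.NumberTheory.ModularForms.LevelSixEtaQExpansions
import Literature.NumberTheory.ModularForms.SerreDerivativeModularForm
import Literature.NumberTheory.EllipticCurves.ModularCurveSturmProofs
import Mathlib.NumberTheory.ModularForms.EisensteinSeries.QExpansion
import HarnessLib

/-!
# Set-up for the weight-4 Sturm identities on `Γ₀(6)`: `E₄|Γ₀(6)`, `ϑg`, and the bound

Eighth file of the level-6 story of the four-step random walk. Provides

* `restrictGamma0Six : ModularForm 𝒮ℒ k → ModularForm (Γ₀(6)) k` and `E4SixForm` (Mathlib's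
  `ModularForm.E₄`) with `E₄^∧(0..4) = 1, 240, 2160, 6720, 17520` (`E_qExpansion_coeff`, `B₄ = −1/30`);
* `nice_E2`, `trunc4_E2` (`1, −24, −72, −96, −168`);
* the Serre derivative `ϑg = Dg − E₂g/6` of `gSix = Dt/t` as `ModularForm (Γ₀(6)) 4`
  (`serreDerivativeGamma0`, previous file) with **`ϑg^∧(0..4) = −1/6, 9, 47, 231, 387`**
  (`serreDerivative_gSix_coeff_le_four`; `(Dg)^∧(n) = n g^∧(n)` from `QExpansionDerivative`);
* the **Sturm bound for `Γ₀(6)`**: a modular form of weight `k` on `Γ₀(6)` whose coefficients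
  `n ≤ k` vanish is zero (`gamma0Six_eq_zero_of_coeff`, from the tree's
  `modularForm_eq_zero_of_qExpansion_coeff_eq_zero`, `[SL₂(ℤ):Γ₀(6)] = 12`).

## References

* J. Sturm, *On the congruence of modular forms*, LNM 1240 (1987), Thm. 1.
* [BorweinEtAl2012] §4 Remark 7 (the level-6 forms).
-/

noncomputable section

open UpperHalfPlane hiding I
open Complex Filter Topology Finset PowerSeries Function EisensteinSeries ModularForm Derivative
open scoped Real MatrixGroups ModularForm Manifold ArithmeticFunction.sigma

open Literature.NumberTheory.EllipticCurves.ModularForms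

namespace Literature.NumberTheory.ModularForms

/-! ### Restriction from `SL₂(ℤ)` to `Γ₀(6)`; `E₄` -/

/-- Restriction of a level-one modular form to `Γ₀(6)`. [folklore] -/
def restrictGamma0Six {k : ℤ} (f : ModularForm 𝒮ℒ k) : ModularForm (CongruenceSubgroup.Gamma0 6) k where
  toFun := f
  slash_action_eq' A hA := by
    obtain ⟨γ, _, rfl⟩ := hA
    exact SlashInvariantFormClass.slash_action_eq f (Matrix.SpecialLinearGroup.mapGL ℝ γ) ⟨γ, rfl⟩
  holo' := ModularFormClass.holo f
  bdd_at_cusps' hcusp := by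
    rw [Subgroup.IsArithmetic.isCusp_iff_isCusp_SL2Z] at hcusp
    rw [OnePoint.isBoundedAt_iff_forall_SL2Z hcusp]
    intro γ _
    exact ModularFormClass.bdd_at_infty_slash f γ

/-- The underlying function. [folklore] -/
theorem coe_restrictGamma0Six {k : ℤ} (f : ModularForm 𝒮ℒ k) : (restrictGamma0Six f : ℍ → ℂ) = f := rfl

/-- **`E₄` on `Γ₀(6)`.** [folklore] -/
def E4SixForm : ModularForm (CongruenceSubgroup.Gamma0 6) 4 := restrictGamma0Six ModularForm.E₄

/-- `σ₃(1..4) = 1, 9, 28, 73`. [folklore] -/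
theorem sigma_three_values : σ 3 1 = 1 ∧ σ 3 2 = 9 ∧ σ 3 3 = 28 ∧ σ 3 4 = 73 := by
  refine ⟨by decide, by decide, by decide, by decide⟩

/-- **`E₄^∧(0..4) = 1, 240, 2160, 6720, 17520`.** [folklore] -/
theorem E4SixForm_coeff_le_four : Trunc4 (qExpansion 1 (⇑E4SixForm)) 1 240 2160 6720 17520 := by
  have h : ∀ m, (qExpansion 1 (⇑E4SixForm)).coeff m =
      if m = 0 then 1 else -(2 * (4 : ℕ) / bernoulli 4 : ℂ) * (σ (4 - 1) m) := fun m => by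
    rw [show (⇑E4SixForm : ℍ → ℂ) = ⇑ModularForm.E₄ from rfl]
    exact E_qExpansion_coeff (by norm_num) (by decide) m
  have hB : (bernoulli 4 : ℚ) = -1 / 30 := by
    rw [bernoulli_eq_bernoulli'_of_ne_one (by norm_num), bernoulli'_four]
  obtain ⟨s1, s2, s3, s4⟩ := sigma_three_values
  refine ⟨?_, ?_, ?_, ?_, ?_⟩ <;> rw [h] <;> norm_num [hB, s1, s2, s3, s4]

/-! ### `E₂` -/

/-- `E₂` is nice of period `1`. [folklore] -/
theorem nice_E2 : Periodic (E2 ∘ ofComplex) 1 ∧ MDiff E2 ∧ IsBoundedAtImInfty E2 := by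
  refine ⟨?_, E2_mdifferentiable, isBoundedAtImInfty_E2⟩
  intro w
  by_cases hw : 0 < w.im
  · have hw1 : 0 < (w + 1).im := by simpa using hw
    simp only [Function.comp_apply, ofComplex_apply_of_im_pos hw, ofComplex_apply_of_im_pos hw1]
    have h := congrFun (E2_slash_action ModularGroup.T) ⟨w, hw⟩
    rw [SL_slash_apply, D2_T, ModularGroup.denom_apply] at h
    simp only [Pi.sub_apply, Pi.zero_apply, smul_zero, sub_zero] at h
    have hT : ModularGroup.T • (⟨w, hw⟩ : ℍ) = ⟨w + 1, hw1⟩ := by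
      apply UpperHalfPlane.ext
      rw [UpperHalfPlane.modular_T_smul]
      simp [UpperHalfPlane.coe_vadd]
      ring
    rw [hT] at h
    have hden : ((ModularGroup.T 1 0 : ℤ) : ℂ) * ((⟨w, hw⟩ : ℍ) : ℂ) + (ModularGroup.T 1 1 : ℤ) = 1 := by
      simp [ModularGroup.T]
    rw [hden] at h
    simpa using h
  · push Not at hw
    have hw1 : (w + 1).im ≤ 0 := by simpa using hw
    simp only [Function.comp_apply, ofComplex_apply_eq_of_im_nonpos hw1 hw]

/-- **`E₂^∧(0..4) = 1, −24, −72, −96, −168`.** [folklore] -/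
theorem trunc4_E2 : Trunc4 (qExpansion 1 E2) 1 (-24) (-72) (-96) (-168) := by
  have h : ∀ m, (qExpansion 1 E2).coeff m = e2Coeff m := fun m =>
    qExpansion_coeff_eq_of_hasSum nice_E2.1 nice_E2.2.1 nice_E2.2.2 hasSum_E2_qParam m
  obtain ⟨e0, e1, e2, e3, e4⟩ := e2Coeff_values
  exact ⟨by rw [h, e0], by rw [h, e1], by rw [h, e2], by rw [h, e3], by rw [h, e4]⟩

/-! ### The Serre derivative `ϑg` of `gSix` -/

/-- Truncated data of `gSix` (`= Dt/t`). [folklore] -/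
theorem trunc4_gSix : Trunc4 (qExpansion 1 (⇑gSixForm)) 1 6 6 42 6 := gSixForm_coeff_le_four

/-- Truncated data of `hSix` (`= ϑZ/Z`). [folklore] -/
theorem trunc4_hSix : Trunc4 (qExpansion 1 (⇑hSixForm)) (-1 / 6) 0 4 (-12) 12 := hSixForm_coeff_le_four

/-- **`ϑg^∧(0..4) = −1/6, 9, 47, 231, 387`** for `ϑg = Dg − E₂g/6`, `g = gSix = Dt/t`. [folklore] -/
theorem serreDerivative_gSix_coeff_le_four :
    Trunc4 (qExpansion 1 (⇑(serreDerivativeGamma0 6 gSixForm))) (-1 / 6) 9 47 231 387 := by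
  have ng := nice_etaQuotient_of_modularForm gSixForm
  -- `ϑg = Dg − (1/6) (E₂ g)` as functions
  have hfun : (⇑(serreDerivativeGamma0 6 gSixForm) : ℍ → ℂ) = D ⇑gSixForm - (1 / 6 : ℂ) • (E2 * ⇑gSixForm) := by
    funext z
    rw [coe_serreDerivativeGamma0, serreDerivative_apply]
    simp only [Pi.sub_apply, Pi.smul_apply, Pi.mul_apply, smul_eq_mul]
    push_cast
    ring
  have nD : Periodic (D ⇑gSixForm ∘ ofComplex) 1 ∧ MDiff (D ⇑gSixForm) ∧ IsBoundedAtImInfty (D ⇑gSixForm) :=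
    ⟨periodic_D ng.1, normalizedDerivOfComplex_mdifferentiable ng.2.1, isBoundedAtImInfty_D ng.1 ng.2.1 ng.2.2⟩
  have nEg := QExpansionAlgebra.nice_mul nice_E2 ng
  rw [hfun, QExpansionAlgebra.qExpansion_sub_of_nice one_pos nD (QExpansionAlgebra.nice_smul _ nEg),
    QExpansionAlgebra.qExpansion_smul_of_nice one_pos _ nEg,
    QExpansionAlgebra.qExpansion_mul_of_nice one_pos nice_E2 ng]
  -- the pieces
  have hD : ∀ n, (qExpansion 1 (D ⇑gSixForm)).coeff n = n * (qExpansion 1 ⇑gSixForm).coeff n :=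
    fun n => qExpansion_D_coeff ng.1 ng.2.1 ng.2.2 n
  obtain ⟨g0, g1, g2, g3, g4⟩ := trunc4_gSix
  have hEg : Trunc4 (qExpansion 1 E2 * qExpansion 1 ⇑gSixForm) 1 (-18) (-210) (-630) (-2178) :=
    trunc4_E2.mul trunc4_gSix (by norm_num) (by norm_num) (by norm_num) (by norm_num) (by norm_num)
  obtain ⟨p0, p1, p2, p3, p4⟩ := hEg
  refine ⟨?_, ?_, ?_, ?_, ?_⟩ <;>
    simp only [map_sub, map_smul, smul_eq_mul, hD, g0, g1, g2, g3, g4, p0, p1, p2, p3, p4] <;>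
    norm_num

/-! ### Sturm's bound for `Γ₀(6)` -/

/-- **Sturm's bound on `Γ₀(6)`**: `[SL₂(ℤ) : Γ₀(6)] = 12`, so a modular form of weight `k ≥ 0` on
`Γ₀(6)` whose `q`-coefficients `a₀, …, a_k` vanish is zero. [cite: Sturm1987, Thm. 1] -/
theorem gamma0Six_eq_zero_of_coeff {k : ℕ} (f : ModularForm (CongruenceSubgroup.Gamma0 6) k)
    (hf : ∀ i < k + 1, (qExpansion 1 (⇑f)).coeff i = 0) : f = 0 := by
  refine modularForm_eq_zero_of_qExpansion_coeff_eq_zero (one_mem_strictPeriods_coe_gamma0 6) f hf ?_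
  rw [card_quotient_subgroupOf_eq_index, index_gamma0_eq_gamma0Index_holds 6, gamma0_data_6.1]
  push_cast
  omega

end Literature.NumberTheory.ModularForms

end
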